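import Mathlib

/-!
# Solo/informed — kernel artefact 4: the norm element of `𝔽_p[C_p]` and the socle filtration

Two pieces of pure algebra behind Part II §7.9 (the corner towers of mechanism (E5)):

* In any commutative ring of characteristic `p`, `∑_{i<p} x^i = (x - 1)^(p-1)`.  In the group
  algebra `𝔽_p[C]` of a cyclic group `C = ⟨σ⟩` of order `p` this says that the NORM ELEMENT
  `N_C = ∑ σ^i` equals `ε^(p-1)` with `ε = σ - 1` (kernel artefact 3b gave `ε^p = 0`), so
  `N_C M = ε^(p-1) M` is the sum of the socles of the free blocks of an `𝔽_p[C]`-module `M`.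
* For a module `M` over a commutative ring and `e : R`, the image of `M[e^(k+1)]` under
  multiplication by `e^k` is `e^k M ∩ M[e]` — the `k+1`-st step `Fil^(k+1)` of the socle
  filtration, which in §7.9 is the set of corner classes that deform to order `k`.

No arithmetic input.
-/

namespace Summit.Langlands.Langlands.Theorems

open Polynomial Finset

/-- In `𝔽_p[X]`: `∑_{i<p} X^i = (X - 1)^(p-1)`. -/
theorem soloInformed_geom_sum_X_eq_X_sub_one_pow (p : ℕ) [hp : Fact p.Prime] :
    (∑ i ∈ range p, (X : (ZMod p)[X]) ^ i) = (X - 1) ^ (p - 1) := by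
  have h1 : (∑ i ∈ range p, (X : (ZMod p)[X]) ^ i) * (X - 1) = (X - 1) ^ (p - 1) * (X - 1) := by
    rw [geom_sum_mul, ← pow_succ, Nat.sub_add_cancel hp.out.one_le, sub_pow_char, one_pow]
  have hne : (X - 1 : (ZMod p)[X]) ≠ 0 := by
    rw [← C_1]
    exact X_sub_C_ne_zero 1
  exact mul_right_cancel₀ hne h1

/-- In any commutative ring of characteristic `p`: `∑_{i<p} x^i = (x - 1)^(p-1)`. -/
theorem soloInformed_geom_sum_eq_sub_one_pow {R : Type*} [CommRing R] (p : ℕ) [hp : Fact p.Prime]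
    [CharP R p] (x : R) :
    (∑ i ∈ range p, x ^ i) = (x - 1) ^ (p - 1) := by
  have h := congrArg (Polynomial.eval₂ (ZMod.castHom (dvd_refl p) R) x)
    (soloInformed_geom_sum_X_eq_X_sub_one_pow p)
  simpa [Polynomial.eval₂_finsetSum, Polynomial.eval₂_pow, Polynomial.eval₂_X,
    Polynomial.eval₂_sub, Polynomial.eval₂_one] using h

/-- The norm element of `𝔽_p[G]` along `g`: `∑_{i<p} g^i = (g - 1)^(p-1)` in
`MonoidAlgebra (ZMod p) G` (for `g` of order `p` the left side is `N_⟨g⟩`). -/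
theorem soloInformed_normElement_eq_sub_one_pow {p : ℕ} [hp : Fact p.Prime] {G : Type*}
    [CommGroup G] (g : G) :
    (∑ i ∈ range p, MonoidAlgebra.of (ZMod p) G (g ^ i)) =
      (MonoidAlgebra.of (ZMod p) G g - 1) ^ (p - 1) := by
  haveI : CharP (MonoidAlgebra (ZMod p) G) p :=
    charP_of_injective_algebraMap (algebraMap (ZMod p) (MonoidAlgebra (ZMod p) G)).injective p
  simp_rw [map_pow]
  exact soloInformed_geom_sum_eq_sub_one_pow p _

/-- Combined with kernel artefact 3b: for `g ^ p = 1`, `(g - 1) * ∑_{i<p} g^i = 0`, i.e. the norm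
element is killed by the augmentation generator (it spans the socle of the free module). -/
theorem soloInformed_sub_one_mul_normElement {p : ℕ} [hp : Fact p.Prime] {G : Type*}
    [CommGroup G] (g : G) (hg : g ^ p = 1) :
    (MonoidAlgebra.of (ZMod p) G g - 1) * (∑ i ∈ range p, MonoidAlgebra.of (ZMod p) G (g ^ i)) = 0 := by
  haveI : CharP (MonoidAlgebra (ZMod p) G) p :=
    charP_of_injective_algebraMap (algebraMap (ZMod p) (MonoidAlgebra (ZMod p) G)).injective p
  rw [soloInformed_normElement_eq_sub_one_pow, ← pow_succ', Nat.sub_add_cancel hp.out.one_le,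
    sub_pow_char, one_pow, ← map_pow, hg, map_one, sub_self]

/-- The socle filtration step: `x` is `e^k m` for some `m` killed by `e^(k+1)` iff `e x = 0` and
`x ∈ e^k M`.  (In §7.9: a corner class deforms to order `k` along a `ℤ/p`-direction iff it lies in
`ε^k N ∩ N[ε]`, `N` the relevant `𝔽_p[C]`-module.) -/
theorem soloInformed_socleFiltration_iff {R M : Type*} [CommRing R] [AddCommGroup M] [Module R M]
    (e : R) (k : ℕ) (x : M) :
    (∃ m : M, e ^ (k + 1) • m = 0 ∧ e ^ k • m = x) ↔ (e • x = 0 ∧ ∃ m : M, e ^ k • m = x) := by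
  constructor
  · rintro ⟨m, hm0, rfl⟩
    refine ⟨?_, m, rfl⟩
    rw [← mul_smul, ← pow_succ', hm0]
  · rintro ⟨hx, m, rfl⟩
    refine ⟨m, ?_, rfl⟩
    rw [pow_succ', mul_smul, hx]

end Summit.Langlands.Langlands.Theorems
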